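import Summits.Ventures.PercRepro.S1TrianglePlusFreeC

/-!
# PercRepro — THE FREE CONE, part D: the structure of two triangles avoiding `x` (p1, gen 20; (C1) only)

The free-cone lemma (part C) counted the triangles avoiding `x`; this module records the STRUCTURE its proof
establishes for two such triangles `T₁ ≠ T₂`: a common point `f` outside the cone with `T₁ ∖ U = T₂ ∖ U = {f}`,
parts `T₁ ∩ U`, `T₂ ∩ U` of size `2`, disjoint, both inside `(C ∪ C') ∖ {x}` for one pair `C ≠ C'` of triangles
through `x`. Used by the `ν = 4` lemma of LEMMA T⁺⁺⁺.

* **`free_cone_two_structure`** — the statement above.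
Axioms: standard.
-/

open scoped Matroid

namespace PercRepro

namespace S1

open Set

variable {α : Type}

/-- **The structure of two triangles avoiding `x` in a free cone with one unit of outside nullity.** -/
theorem free_cone_two_structure (M : Matroid α) [M.Finite]
    (hC1 : ∀ L ⊆ M.E, M.eRk L = 2 → L.ncard ≤ 3) {x : α} (hx : M.IsNonloop x)
    (s : Finset (Set α)) (hmem : ∀ C, C ∈ s ↔ C ∈ ThmN.trianglesThrough M x)
    (hfree : M.eRk ({x} ∪ ⋃ C ∈ s, C) = ((1 + s.card : ℕ) : ℕ∞))
    (hd : M.E.encard = M.eRank + ((s.card + 1 : ℕ) : ℕ∞))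
    {T₁ T₂ : Set α} (h₁ : T₁ ∈ ThmN.triangles M ∧ x ∉ T₁) (h₂ : T₂ ∈ ThmN.triangles M ∧ x ∉ T₂)
    (h12 : T₁ ≠ T₂) :
    ∃ f, f ∉ ({x} ∪ ⋃ C ∈ s, C) ∧ f ∈ M.E ∧ f ∈ T₁ ∧ f ∈ T₂ ∧
      T₁ \ ({x} ∪ ⋃ C ∈ s, C) = {f} ∧ T₂ \ ({x} ∪ ⋃ C ∈ s, C) = {f} ∧
      (T₁ ∩ ({x} ∪ ⋃ C ∈ s, C)).ncard = 2 ∧ (T₂ ∩ ({x} ∪ ⋃ C ∈ s, C)).ncard = 2 ∧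
      Disjoint (T₁ ∩ ({x} ∪ ⋃ C ∈ s, C)) (T₂ ∩ ({x} ∪ ⋃ C ∈ s, C)) ∧
      ∃ C ∈ s, ∃ C' ∈ s, C ≠ C' ∧ T₁ ∩ ({x} ∪ ⋃ C ∈ s, C) ⊆ (C ∪ C') \ {x} ∧
        T₂ ∩ ({x} ∪ ⋃ C ∈ s, C) ⊆ (C ∪ C') \ {x} := by
  classical
  have hs : ∀ C ∈ s, C ∈ ThmN.trianglesThrough M x := fun C hC => (hmem C).1 hC
  set U : Set α := {x} ∪ ⋃ C ∈ s, C with hU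
  have hUE : U ⊆ M.E := by
    intro z hz
    rcases hz with hz | hz
    · rw [Set.mem_singleton_iff.1 hz]; exact hx.mem_ground
    · obtain ⟨C, hC, hzC⟩ := Set.mem_iUnion₂.1 hz
      exact (hs C hC).1.subset_ground hzC
  have hUfin : U.Finite := M.ground_finite.subset hUE
  have hxU : x ∈ U := Set.mem_union_left _ (Set.mem_singleton x)
  obtain ⟨-, hcU⟩ := ThmN.eRk_le_and_ncard_eq_of_triangles M hC1 hx s hs
  set A : Set (Set α) := {T | T ∈ ThmN.triangles M ∧ x ∉ T} with hA
  have hAfin : A.Finite :=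
    M.ground_finite.finite_subsets.subset (fun T hT => hT.1.1.subset_ground)
  -- the numbers: `t = #s`, `m = |E ∖ U|`, `r(E) = t + m`, `r(U) = t + 1`
  have hneR : M.eRank ≠ ⊤ :=
    (M.eRank_le_encard_ground.trans_lt M.ground_finite.encard_lt_top).ne
  obtain ⟨r, hr'⟩ := ENat.ne_top_iff_exists.1 hneR
  have hcard : M.E.ncard = U.ncard + (M.E \ U).ncard := by
    conv_lhs => rw [← Set.union_sdiff_cancel hUE]
    exact Set.ncard_union_eq Set.disjoint_sdiff_right hUfin (M.ground_finite.sdiff)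
  have e3 : M.E.ncard = r + (s.card + 1) := by
    rw [← hr', ← M.ground_finite.cast_ncard_eq] at hd
    exact_mod_cast hd
  have hcU' : U.ncard = 1 + 2 * s.card := hcU
  have hrE : r = s.card + (M.E \ U).ncard := by omega
  -- STEP 1: a triangle avoiding `x` has a point outside the cone
  have hout : ∀ T ∈ A, ∃ z ∈ T, z ∉ U := by
    intro T hT
    by_contra hnot
    have hTU : T ⊆ U := fun z hz => by
      by_contra hzU
      exact hnot ⟨z, hz, hzU⟩
    exact not_subset_cone_of_free M hC1 hx s hmem hfree hT.1 hT.2 hTU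
  -- STEP 2: for `T ∈ A`, `r(E) = r(U ∪ T) + |E ∖ (U ∪ T)|`, hence every circuit lies in `U ∪ T`
  have hcirc : ∀ T ∈ A, ∀ {C : Set α}, M.IsCircuit C → C ⊆ U ∪ T := by
    intro T hT C hC
    have hTE : T ⊆ M.E := hT.1.1.subset_ground
    have hTfin : T.Finite := M.ground_finite.subset hTE
    obtain ⟨z, hzT, hzU⟩ := hout T hT
    -- `U ∪ T ⊆ cl (U ∪ (T ∖ {z}))`
    have hcl : U ∪ T ⊆ M.closure (U ∪ (T \ {z})) := by
      apply Set.union_subset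
      · intro w hw
        exact M.subset_closure (U ∪ (T \ {z}))
          (Set.union_subset hUE (Set.sdiff_subset.trans hTE)) (Set.mem_union_left _ hw)
      · intro w hw
        by_cases hwz : w = z
        · rw [hwz]
          have h1 : z ∈ M.closure (T \ {z}) := hT.1.1.mem_closure_sdiff_singleton_of_mem hzT
          exact M.closure_subset_closure Set.subset_union_right h1
        · exact M.subset_closure (U ∪ (T \ {z}))
            (Set.union_subset hUE (Set.sdiff_subset.trans hTE)) (Set.mem_union_right _ ⟨hw, hwz⟩)
    have hrUT : M.eRk (U ∪ T) ≤ M.eRk U + ((T \ {z}) \ U).encard := by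
      calc M.eRk (U ∪ T) ≤ M.eRk (M.closure (U ∪ (T \ {z}))) := M.eRk_mono hcl
        _ = M.eRk (U ∪ (T \ {z})) := M.eRk_closure_eq _
        _ = M.eRk (U ∪ ((T \ {z}) \ U)) := by rw [Set.union_sdiff_self]
        _ ≤ M.eRk U + ((T \ {z}) \ U).encard := M.eRk_union_le_eRk_add_encard _ _
    have hsplitT : (T \ {z}) \ U = (T \ U) \ {z} := by
      ext w; simp only [Set.mem_sdiff, Set.mem_singleton_iff]; tauto
    have hcz : ((T \ U) \ {z}).ncard + 1 = (T \ U).ncard :=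
      Set.ncard_sdiff_singleton_add_one ⟨hzT, hzU⟩ (hTfin.sdiff)
    -- `|E ∖ (U ∪ T)| + |T ∖ U| = |E ∖ U|`
    have hEUT : (M.E \ (U ∪ T)).ncard + (T \ U).ncard = (M.E \ U).ncard := by
      have h1 : M.E \ U = (M.E \ (U ∪ T)) ∪ (T \ U) := by
        ext w
        simp only [Set.mem_sdiff, Set.mem_union, not_or]
        constructor
        · rintro ⟨hwE, hwU⟩
          by_cases hwT : w ∈ T
          · exact Or.inr ⟨hwT, hwU⟩
          · exact Or.inl ⟨hwE, hwU, hwT⟩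
        · rintro (⟨hwE, hwU, -⟩ | ⟨hwT, hwU⟩)
          · exact ⟨hwE, hwU⟩
          · exact ⟨hTE hwT, hwU⟩
      rw [h1]
      refine (Set.ncard_union_eq ?_ (M.ground_finite.sdiff) (hTfin.sdiff)).symm
      rw [Set.disjoint_left]
      rintro w ⟨-, hw⟩ ⟨hwT, -⟩
      exact hw (Set.mem_union_right _ hwT)
    -- `r(E) ≤ r(U ∪ T) + |E ∖ (U ∪ T)|`
    have hUTE : U ∪ T ⊆ M.E := Set.union_subset hUE hTE
    have hrE' : M.eRank ≤ M.eRk (U ∪ T) + (M.E \ (U ∪ T)).encard := by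
      have := M.eRk_union_le_eRk_add_encard (U ∪ T) (M.E \ (U ∪ T))
      rwa [Set.union_sdiff_cancel hUTE, M.eRk_ground] at this
    -- pass to `ℕ`
    have hneUT : M.eRk (U ∪ T) ≠ ⊤ :=
      ((M.eRk_le_encard _).trans_lt (hUfin.union hTfin).encard_lt_top).ne
    obtain ⟨b, hb⟩ := ENat.ne_top_iff_exists.1 hneUT
    rw [hsplitT, ← hb, hfree, ← ((hTfin.sdiff).sdiff (t := {z})).cast_ncard_eq] at hrUT
    have f1 : b ≤ 1 + s.card + ((T \ U) \ {z}).ncard := by exact_mod_cast hrUT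
    rw [← hb, ← hr', ← (M.ground_finite.sdiff (t := U ∪ T)).cast_ncard_eq] at hrE'
    have f2 : r ≤ b + (M.E \ (U ∪ T)).ncard := by exact_mod_cast hrE'
    -- hence equality, and the circuit lemma applies to `W = U ∪ T`
    have hkey : M.eRk (U ∪ T) + (M.E \ (U ∪ T)).encard ≤ M.eRank := by
      rw [← hb, ← hr', ← (M.ground_finite.sdiff (t := U ∪ T)).cast_ncard_eq]
      have : b + (M.E \ (U ∪ T)).ncard ≤ r := by omega
      exact_mod_cast this
    exact IsCircuit.subset_of_eRk_add_encard_le M hUTE hkey hC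
  -- STEP 3: all triangles avoiding `x` have the same part outside the cone
  have hsame : ∀ T ∈ A, ∀ T' ∈ A, T \ U = T' \ U := by
    intro T hT T' hT'
    apply Set.Subset.antisymm
    · rintro w ⟨hwT, hwU⟩
      rcases hcirc T' hT' hT.1.1 hwT with h | h
      · exact absurd h hwU
      · exact ⟨h, hwU⟩
    · rintro w ⟨hwT', hwU⟩
      rcases hcirc T hT hT'.1.1 hwT' with h | h
      · exact absurd h hwU
      · exact ⟨h, hwU⟩
  have hT₁E : T₁ ⊆ M.E := h₁.1.1.subset_ground
  have hT₁fin : T₁.Finite := M.ground_finite.subset hT₁E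
  set Z : Set α := T₁ \ U with hZ
  have hZ₂ : T₂ \ U = Z := hsame T₂ h₂ T₁ h₁
  have hZfin : Z.Finite := hT₁fin.sdiff
  have hZpos : 1 ≤ Z.ncard := by
    obtain ⟨z, hzT, hzU⟩ := hout T₁ h₁
    have : z ∈ Z := ⟨hzT, hzU⟩
    exact (Set.ncard_pos hZfin).2 ⟨z, this⟩
  have hZle : Z.ncard ≤ 3 := by
    calc Z.ncard ≤ T₁.ncard := Set.ncard_le_ncard Set.sdiff_subset hT₁fin
      _ = 3 := h₁.1.2
  -- a triangle `T` avoiding `x` is `Z ∪ (T ∩ U)` with `|T ∩ U| = 3 − |Z|`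
  have hdecomp : ∀ T ∈ A, T \ U = Z → (T ∩ U).ncard + Z.ncard = 3 := by
    intro T hT hTZ
    have hTfin : T.Finite := M.ground_finite.subset hT.1.1.subset_ground
    have h1 : (T \ (T ∩ U)).ncard + (T ∩ U).ncard = T.ncard :=
      Set.ncard_sdiff_add_ncard_of_subset Set.inter_subset_left hTfin
    have h2 : T \ (T ∩ U) = T \ U := by
      ext w; simp only [Set.mem_sdiff, Set.mem_inter_iff, not_and]; tauto
    rw [h2, hTZ, hT.1.2] at h1
    omega
  -- two distinct triangles avoiding `x` meet only inside `Z`... and if `|Z| ≥ 2` they cannot be distinct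
  have hZ1 : Z.ncard = 1 := by
    rcases Nat.lt_or_ge Z.ncard 2 with h | h
    · omega
    · exfalso
      -- `T₁ ≠ T₂`, both contain `Z` with `|Z| ≥ 2`: two points `f ≠ g` in both, so `T₁ ∩ T₂ = {f}` fails
      obtain ⟨f, g, hfZ, hgZ, hfg⟩ := (Set.one_lt_ncard_iff hZfin).1 h
      have hfT₁ : f ∈ T₁ := hfZ.1
      have hgT₁ : g ∈ T₁ := hgZ.1
      have hfT₂ : f ∈ T₂ := by rw [← hZ₂] at hfZ; exact hfZ.1
      have hgT₂ : g ∈ T₂ := by rw [← hZ₂] at hgZ; exact hgZ.1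
      have := inter_eq_of_triangles_through M hC1 h₁.1 h₂.1 hfT₁ hfT₂ h12
      have hg : g ∈ T₁ ∩ T₂ := ⟨hgT₁, hgT₂⟩
      rw [this] at hg
      exact hfg (Set.mem_singleton_iff.1 hg).symm
  obtain ⟨f, hfZ⟩ := Set.ncard_eq_one.1 hZ1
  have hfU : f ∉ U := by
    have : f ∈ Z := hfZ ▸ Set.mem_singleton f
    exact this.2
  have hfE : f ∈ M.E := by
    have : f ∈ Z := hfZ ▸ Set.mem_singleton f
    exact hT₁E this.1
  -- every `T ∈ A` with `T ∖ U = Z` is `{f, a, b}` with `a ≠ b ∈ U ∖ {x}`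
  have hshape : ∀ T ∈ A, T \ U = Z → f ∈ T ∧ (T ∩ U).ncard = 2 := by
    intro T hT hTZ
    have h1 := hdecomp T hT hTZ
    rw [hZ1] at h1
    refine ⟨?_, by omega⟩
    have : f ∈ T \ U := by rw [hTZ, hfZ]; exact Set.mem_singleton f
    exact this.1
  -- the two triangles through `x` carrying the points of `T ∩ U`, and the plane they span
  have hpair_of : ∀ T ∈ A, T \ U = Z → ∀ a ∈ T ∩ U, ∃ C ∈ s, a ∈ C := by
    intro T hT hTZ a ha
    rcases ha.2 with h | h
    · exact absurd (Set.mem_singleton_iff.1 h ▸ ha.1) hT.2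
    · obtain ⟨C, hC, haC⟩ := Set.mem_iUnion₂.1 h
      exact ⟨C, hC, haC⟩
  -- `f ∈ cl (C ∪ C')` whenever `{f, a, b}` is a triangle avoiding `x` with `a ∈ C`, `b ∈ C'`, `a ≠ b`
  -- FINISH: the parts `T_k ∩ U` of the three triangles are pairwise disjoint 2-subsets of the 4-point set
  -- `(C ∪ C') ∖ {x}`, where `{C, C'}` is the pair of `T₁`
  have hsh₁ := hshape T₁ h₁ rfl
  obtain ⟨a, b, hab, hT₁U⟩ := Set.ncard_eq_two.1 hsh₁.2
  have haT₁ : a ∈ T₁ ∩ U := by rw [hT₁U]; simp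
  have hbT₁ : b ∈ T₁ ∩ U := by rw [hT₁U]; simp
  obtain ⟨C, hC, haC⟩ := hpair_of T₁ h₁ rfl a haT₁
  obtain ⟨C', hC', hbC'⟩ := hpair_of T₁ h₁ rfl b hbT₁
  have hCC' : C ≠ C' :=
    (pair_of_triangle_avoiding M hC1 hx s hs hfU hfE h₁.1 h₁.2 (hshape T₁ h₁ rfl).1 haT₁ hbT₁ hab
      hC haC hC' hbC').1
  -- every part lies in `(C ∪ C') ∖ {x}`
  have hpart : ∀ T ∈ A, T \ U = Z → T ∩ U ⊆ (C ∪ C') \ {x} := by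
    intro T hT hTZ w hw
    obtain ⟨D, hD, hwD⟩ := hpair_of T hT hTZ w hw
    have := same_pair_of_triangles_avoiding M hC1 hx s hs hfree hfU hfE h₁.1 h₁.2 (hshape T₁ h₁ rfl).1
      haT₁ hbT₁ hab hC haC hC' hbC' hT.1 hT.2 (hshape T hT hTZ).1 (hshape T hT hTZ).2 hw hD hwD
    refine ⟨?_, fun h => hT.2 (Set.mem_singleton_iff.1 h ▸ hw.1)⟩
    rcases this with rfl | rfl
    · exact Set.mem_union_left _ hwD
    · exact Set.mem_union_right _ hwD
  -- the parts are pairwise disjoint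
  have hdisj : ∀ T ∈ A, ∀ T' ∈ A, T ≠ T' → Disjoint (T ∩ U) (T' ∩ U) := by
    intro T hT T' hT' hne
    rw [Set.disjoint_left]
    rintro w ⟨hwT, hwU⟩ ⟨hwT', -⟩
    have hfT : f ∈ T := (hshape T hT (hsame T hT T₁ h₁)).1
    have hfT' : f ∈ T' := (hshape T' hT' (hsame T' hT' T₁ h₁)).1
    have := inter_eq_of_triangles_through M hC1 hT.1 hT'.1 hfT hfT' hne
    have hw : w ∈ T ∩ T' := ⟨hwT, hwT'⟩
    rw [this] at hw
    exact hfU (Set.mem_singleton_iff.1 hw ▸ hwU)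
  refine ⟨f, hfU, hfE, (hshape T₁ h₁ rfl).1, (hshape T₂ h₂ hZ₂).1, ?_, ?_, hsh₁.2, (hshape T₂ h₂ hZ₂).2,
    hdisj T₁ h₁ T₂ h₂ h12, C, hC, C', hC', hCC', hpart T₁ h₁ rfl, hpart T₂ h₂ hZ₂⟩
  · exact hfZ
  · rw [hZ₂]; exact hfZ

end S1

end PercRepro
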